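import Literature.Barriers.FinalStateConjecture.GregoryLaflammeInstability
import Mathlib.Analysis.Calculus.ContDiff.Deriv
import Mathlib.Analysis.Calculus.Deriv.Inv
import Mathlib.Analysis.SpecialFunctions.Pow.Deriv
import Mathlib.Analysis.SpecialFunctions.ExpDeriv
import Mathlib.MeasureTheory.Integral.Bochner.Set
import HarnessLib

/-!
# The Gregory–Laflamme instability: Collingbourne's Schrödinger reformulation and the reduction of Theorem 1.1 to two analytic facts
(`Literature/Barriers/FinalStateConjecture/`, sibling of `GregoryLaflammeInstability.lean`;
namespace `Literature.Barriers.FinalStateConjecture`)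

S. C. Collingbourne, *The Gregory–Laflamme instability of the Schwarzschild black string
exterior*, J. Math. Phys. 62 (2021) 032502 = arXiv:2007.08441 (key `Collingbourne2021`), §4.
The named fact `GregoryLaflammeInstability` of the sibling file is Proposition 4.1/4.6 of the
source: a smooth solution `𝔥` of the radial ODE (HZX) on `x ∈ (1, ∞)` with `μ̂ > 1/(20√10)`
whose rescaling `𝔥̃ = 𝔥/w`, `w = (1 + ω̂²x³)/x`, has finite `H¹(ℝ)`-norm in the tortoise
variable `x_* = x + log(x − 1)`. The printed proof (§4.1–§4.4) factors through the
Schrödinger form (ODEF) `−d²𝔥̃/dx_*² + V 𝔥̃ = −μ̂² 𝔥̃` and two analytic inputs, which this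
file vendors as named facts (D-0014, nothing asserted) and from which it PROVES the barrier
fact:

* `IsGLSchrodingerMode ω E u` — `u` is a smooth solution on `(1, ∞)` of (ODEF) with spectral
  parameter `E` (i.e. `E = −μ̂²`), written in the variable `x`: since `d/dx_* = ((x−1)/x) d/dx`,
  (ODEF) reads `u'' + u'/(x(x−1)) = (x²/(x−1)²)(V − E) u` (§4.1, eqs. (ODEF), (pot)).
* `GregoryLaflammeTestEnergyBound` — Proposition 4.5 in the quantitative form printed at the
  end of its proof (p. 22): for `|ω̂| ∈ [3/10, 8/10]` the test function
  `u_T = x(1+|ω̂|²x³)(x−1)^{1/100} e^{−4|ω̂|(x−1)}` lies in `H¹(ℝ)` and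
  `E(u_T)/‖u_T‖²_{L²(ℝ)} < −1/4000` ("Hence, `E₀ ≤ E(u_T)/‖u_T‖²_{L²(ℝ)} < −1/4000 < 0` for all
  `|ω̂| ∈ [3/10, 8/10]`"), both integrals written in the `x`-variable as on pp. 20–21.
* `GregoryLaflammeNegativeEigenfunction` — the variational principle, Proposition 4.3 with
  Corollary 4.4, the Euler–Lagrange step and the regularity Theorem 8.3, as combined in the
  proof of Proposition 4.6 (p. 22): if some `H¹` function has Rayleigh quotient `< E' < 0`, then (the
  infimum `E₀` being `< E' < 0`) there is a minimiser, which is a smooth solution of (ODEF) with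
  `−μ̂² = E₀ ≤ E'`, not identically zero (`‖u‖_{L²(ℝ)} = 1`) and in `H¹(ℝ)`. Recorded in the
  weaker form "there exist `E ≤ E'` and a smooth `H¹` solution `u ≢ 0` of (ODEF) with spectral
  parameter `E`", for test functions that are `C¹` on `(1, ∞)`.
* `GregoryLaflammeInstability_of` — **proved**: the two named facts imply
  `GregoryLaflammeInstability`. This is §4.1 of the source (Prop. 7.1 applied with
  `s = x_*`, `w = (1+ω̂²x³)/x`): if `u` solves (ODEF) with `E = −μ̂²` then `𝔥 = w u` solves
  (HZX) — the two identities `2w' + p_ω̂ w = w/(x(x−1))` (the weight equation (4.3)) and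
  `w'' + p_ω̂ w' + q_ω̂ w = −(x²/(x−1)²) V w` (the potential (pot)) are checked by `field_simp;
  ring` — together with `μ̂ = √(−E) > √(1/4000) = 1/(20√10)`.

The discharge of the two named facts (and hence of `GregoryLaflammeInstability`) is the subject
of the sibling `…Proofs.lean` files; this file fixes the decomposition.

## References

* S. C. Collingbourne, J. Math. Phys. 62 (2021) 032502 = arXiv:2007.08441: §4.1 eqs. (HZX),
  (4.3) [weight ODE], (ODEF), (pot) (p. 19); Prop. 4.3, Cor. 4.4 (pp. 19–20); Prop. 4.5 and its
  proof (pp. 20–22); Prop. 4.6 and its proof (p. 22); Prop. 7.1 (p. 26); Thm. 8.3 (p. 27).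
  Key `Collingbourne2021`.
-/

noncomputable section

open MeasureTheory Set Filter Topology


namespace Literature.Barriers.FinalStateConjecture

/-! ### The Schrödinger form (ODEF) in the variable `x ∈ (1, ∞)` -/

/-- `u` is a **smooth solution of Collingbourne's Schrödinger equation (ODEF) with spectral
parameter `E`** on the exterior, written in the variable `x ∈ (1, ∞)`:
`−d²u/dx_*² + V u = E u` with `x_* = x + log(x − 1)`, `d/dx_* = ((x−1)/x) d/dx` and `V` the
Gregory–Laflamme potential `glPotential` (eq. (pot)); expanding
`d²u/dx_*² = ((x−1)/x)² u'' + ((x−1)/x³) u'` and multiplying by `x²/(x−1)²` this is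
`u'' + u'/(x(x−1)) = (x²/(x−1)²)(V(x) − E) u` for all `x > 1`. The eigenvalue equation of
Prop. 4.6 is the case `E = −μ̂²`. Smoothness is `C^∞` on the open half-line (Prop. 4.6: "a
`C^∞(ℝ)` solution `𝔥̃` to the Schrödinger equation (ODEF)", `x_* ∈ ℝ ↔ x ∈ (1, ∞)`); `deriv`
is the ordinary derivative, which on the open set `(1, ∞)` is the derivative of the
restriction. [cite: Collingbourne2021, §4.1 eqs. (ODEF), (pot) and Prop. 4.6] -/
def IsGLSchrodingerMode (ω E : ℝ) (u : ℝ → ℝ) : Prop :=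
  ContDiffOn ℝ ((⊤ : ℕ∞) : WithTop ℕ∞) u (Ioi 1) ∧
    ∀ x ∈ Ioi (1 : ℝ), deriv (deriv u) x + deriv u x / (x * (x - 1)) =
      x ^ 2 / (x - 1) ^ 2 * (glPotential ω x - E) * u x

/-! ### The two analytic inputs of §4 as named facts -/

/-- **Proposition 4.5 of Collingbourne, quantitative form (named fact, D-0014: nothing
asserted).** "Define `u_T(x_*) := x(1+|ω̂|²x³)(x−1)^{1/n} e^{−4|ω̂|(x−1)}` [...]. Then
`u_T ∈ H¹(ℝ)` and, for `n = 100` and `|ω̂| ∈ [3/10, 8/10]`, `E₀ ≤ E(u_T) < 0`", with the bound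
actually established at the end of the proof (p. 22): "Hence,
`E₀ ≤ E(u_T)/‖u_T‖²_{L²(ℝ)} < −1/4000 < 0` for all `|ω̂| ∈ [3/10, 8/10]`." Rendered in the
`x`-variable of pp. 20–21 (`‖u‖²_{L²(ℝ)} = ∫₁^∞ |u|² (x/(x−1)) dx`,
`E(u) = ∫₁^∞ (|((x−1)/x) u'|² + V u²)(x/(x−1)) dx`): for `3/10 ≤ |ω̂| ≤ 8/10`, `u_T` has finite
`H¹(ℝ)`-norm, its energy density is integrable on `(1, ∞)`, and
`E(u_T) < −(1/4000) ‖u_T‖²_{L²(ℝ)}`. The source obtains this by evaluating all integrals through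
`I_k = Γ(2/n) U(2/n, k + 2/n; 8|ω̂|)` and checking the sign of an explicit polynomial
`𝔭(100, |ω̂|)` ("via Sturm's algorithm"). Implies `GregoryLaflammeTestEnergyNegative`.
[cite: Collingbourne2021, Prop. 4.5 and its proof, pp. 20–22] -/
def GregoryLaflammeTestEnergyBound : Prop :=
  ∀ ω : ℝ, 3 / 10 ≤ |ω| → |ω| ≤ 8 / 10 →
    HasFiniteGLH1Norm (glTestFunction ω) ∧
      IntegrableOn (glEnergyDensity ω (glTestFunction ω)) (Ioi 1) ∧
        ∫ x in Ioi 1, glEnergyDensity ω (glTestFunction ω) x <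
          -(1 / 4000) * ∫ x in Ioi 1, glTestFunction ω x ^ 2 * (x / (x - 1))

/-- **The variational principle of Collingbourne's §4 (Prop. 4.3 with Cor. 4.4, the
Euler–Lagrange equation and the regularity Theorem 8.3, as combined in the proof of Prop. 4.6;
named fact, D-0014: nothing asserted).** Prop. 4.3/Cor. 4.4: with
`E₀ := inf {E(v) : v ∈ H¹(ℝ), ‖v‖_{L²(ℝ)} = 1}`, `E(v) = ⟨∇v, ∇v⟩ + ⟨Vv, v⟩`, "If `E₀ < 0`,
then there exists `u ∈ H¹(ℝ)` such that `‖u‖_{L²(ℝ)} = 1` and `E(u) = E₀`"; proof of Prop. 4.6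
(p. 22): "By standard Euler–Lagrange methods [...] `u` will weakly solve the ODE
`−d²u/dx_*² + V(x_*) u = −μ̂² u` with `−μ̂² = E₀`. [...] From the regularity theorem 8.3, any
`u ∈ H¹(ℝ)` which weakly solves the Schrödinger equation (ODEF) is in fact smooth."
Consequently, whenever some `ψ ∈ H¹(ℝ)` has `E(ψ) < E' ‖ψ‖²_{L²(ℝ)}` with `E' < 0` (so that
`E₀ < E' < 0`), there are `E ≤ E'` (namely `E = E₀`) and a smooth solution `u ≢ 0` of (ODEF)
with spectral parameter `E` lying in `H¹(ℝ)`. Rendered in the `x`-variable (densities of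
pp. 20–21, `HasFiniteGLH1Norm`, `glEnergyDensity`, `IsGLSchrodingerMode`), for every `ω̂ ≠ 0`
(the standing assumption of §3–§4; Cor. 4.4 places no further restriction on `ω̂`) and for test
functions `ψ` that are `C¹` on `(1, ∞)` (a subclass of `H¹(ℝ)`; the source allows any
`ψ ∈ H¹(ℝ)`).
[cite: Collingbourne2021, Prop. 4.3, Cor. 4.4, Thm. 8.3 and proof of Prop. 4.6 (p. 22)] -/
def GregoryLaflammeNegativeEigenfunction : Prop :=
  ∀ ω E' : ℝ, ω ≠ 0 → E' < 0 →
    (∃ ψ : ℝ → ℝ, ContDiffOn ℝ 1 ψ (Ioi 1) ∧ HasFiniteGLH1Norm ψ ∧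
        IntegrableOn (glEnergyDensity ω ψ) (Ioi 1) ∧
          ∫ x in Ioi 1, glEnergyDensity ω ψ x < E' * ∫ x in Ioi 1, ψ x ^ 2 * (x / (x - 1))) →
      ∃ E ≤ E', ∃ u : ℝ → ℝ, IsGLSchrodingerMode ω E u ∧ (∃ x ∈ Ioi (1 : ℝ), u x ≠ 0) ∧
        HasFiniteGLH1Norm u

/-! ### §4.1: from (ODEF) back to (HZX) -/

/-- The weight is `w(x) = 1/x + ω̂²x²` (also at `x = 0`, by the junk conventions). [folklore] -/
lemma glWeight_eq (ω x : ℝ) : glWeight ω x = x⁻¹ + ω ^ 2 * x ^ 2 := by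
  unfold glWeight
  rcases eq_or_ne x 0 with rfl | hx
  · simp
  · field_simp

/-- `w > 0` on the exterior `x > 1`. [folklore] -/
lemma glWeight_pos (ω : ℝ) {x : ℝ} (hx : 1 < x) : 0 < glWeight ω x := by
  have hx0 : 0 < x := lt_trans one_pos hx
  unfold glWeight
  positivity

/-- `w'(x) = −1/x² + 2ω̂²x`. [folklore] -/
lemma hasDerivAt_glWeight (ω : ℝ) {x : ℝ} (hx : x ≠ 0) :
    HasDerivAt (glWeight ω) (-(x ^ 2)⁻¹ + ω ^ 2 * (2 * x)) x := by
  have h : glWeight ω = fun y ↦ y⁻¹ + ω ^ 2 * y ^ 2 := funext (glWeight_eq ω)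
  rw [h]
  refine ((hasDerivAt_inv hx).add ((hasDerivAt_pow 2 x).const_mul (ω ^ 2))).congr_deriv ?_
  push_cast
  ring

/-- `w''(x) = 2/x³ + 2ω̂²`. [folklore] -/
lemma hasDerivAt_deriv_glWeight (ω : ℝ) {x : ℝ} (hx : x ≠ 0) :
    HasDerivAt (deriv (glWeight ω)) (2 * (x ^ 3)⁻¹ + 2 * ω ^ 2) x := by
  have h : deriv (glWeight ω) =ᶠ[𝓝 x] fun y ↦ -(y ^ 2)⁻¹ + ω ^ 2 * (2 * y) := by
    filter_upwards [isOpen_ne.mem_nhds hx] with y hy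
    exact (hasDerivAt_glWeight ω hy).deriv
  refine HasDerivAt.congr_of_eventuallyEq ?_ h
  have h1 : HasDerivAt (fun y : ℝ ↦ (y ^ 2)⁻¹) (-(↑(2 : ℕ) * x ^ (2 - 1)) / (x ^ 2) ^ 2) x :=
    (hasDerivAt_pow 2 x).inv (pow_ne_zero 2 hx)
  have h2 : HasDerivAt (fun y : ℝ ↦ -(y ^ 2)⁻¹ + ω ^ 2 * (2 * y))
      (-(-(↑(2 : ℕ) * x ^ (2 - 1)) / (x ^ 2) ^ 2) + ω ^ 2 * (2 * 1)) x :=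
    h1.neg.add (((hasDerivAt_id' x).const_mul 2).const_mul (ω ^ 2))
  refine h2.congr_deriv ?_
  push_cast
  field_simp

/-- **The weight equation (4.3):** `2w' + p_ω̂ w = w/(x(x−1))`, i.e.
`w' + ((1 − 2ω̂²x³)/(x(1+ω̂²x³))) w = 0` — the condition of Prop. 7.1 killing the first-order
term. [cite: Collingbourne2021, §4.1 eq. (4.3) and Prop. 7.1] -/
lemma glWeight_equation (ω : ℝ) {x : ℝ} (hx : 1 < x) :
    2 * (-(x ^ 2)⁻¹ + ω ^ 2 * (2 * x)) + glP ω x * glWeight ω x =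
      glWeight ω x / (x * (x - 1)) := by
  have hx0' : 0 < x := lt_trans one_pos hx
  have hx0 : x ≠ 0 := hx0'.ne'
  have hx1 : x - 1 ≠ 0 := sub_ne_zero.2 hx.ne'
  have hx2 : ω ^ 2 * x ^ 3 + 1 ≠ 0 := by positivity
  rw [glWeight_eq]
  unfold glP
  field_simp
  ring

/-- **The potential identity (pot):** `w'' + p_ω̂ w' + q_ω̂ w = −(x²/(x−1)²) V w` — the
zeroth-order coefficient of (HZX) after the substitution `𝔥 = w 𝔥̃`, `x_* = x + log(x−1)`
(Prop. 7.1, eq. (PotT)). [cite: Collingbourne2021, §4.1 eq. (pot) and Prop. 7.1] -/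
lemma glPotential_equation (ω : ℝ) {x : ℝ} (hx : 1 < x) :
    (2 * (x ^ 3)⁻¹ + 2 * ω ^ 2) + glP ω x * (-(x ^ 2)⁻¹ + ω ^ 2 * (2 * x)) +
        glQ ω x * glWeight ω x =
      -(x ^ 2 / (x - 1) ^ 2) * glPotential ω x * glWeight ω x := by
  have hx0' : 0 < x := lt_trans one_pos hx
  have hx0 : x ≠ 0 := hx0'.ne'
  have hx1 : x - 1 ≠ 0 := sub_ne_zero.2 hx.ne'
  have hx2 : ω ^ 2 * x ^ 3 + 1 ≠ 0 := by positivity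
  have hx3 : 1 + ω ^ 2 * x ^ 3 ≠ 0 := by positivity
  rw [glWeight_eq]
  unfold glP glQ glPotential
  field_simp
  ring

/-- **§4.1 / Prop. 7.1: a smooth solution of (ODEF) with `E = −μ̂²` gives the smooth solution
`𝔥 = w 𝔥̃` of (HZX).** [cite: Collingbourne2021, §4.1 and Prop. 7.1] -/
theorem IsGLSchrodingerMode.isGLRadialMode {ω E μ : ℝ} {u : ℝ → ℝ}
    (hu : IsGLSchrodingerMode ω E u) (hμ : μ ^ 2 = -E) :
    IsGLRadialMode ω μ (fun x ↦ glWeight ω x * u x) := by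
  have hopen : IsOpen (Ioi (1 : ℝ)) := isOpen_Ioi
  obtain ⟨hsmooth, hode⟩ := hu
  have hwsmooth : ContDiffOn ℝ ((⊤ : ℕ∞) : WithTop ℕ∞) (glWeight ω) (Ioi 1) := by
    have h : glWeight ω = fun y ↦ y⁻¹ + ω ^ 2 * y ^ 2 := funext (glWeight_eq ω)
    rw [h]
    exact ContDiffOn.add (contDiffOn_inv ℝ |>.mono fun y (hy : 1 < y) ↦ by
      simp only [mem_compl_iff, mem_singleton_iff]; exact ne_of_gt (lt_trans one_pos hy))
      (by fun_prop)
  refine ⟨hwsmooth.mul hsmooth, fun x hx ↦ ?_⟩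
  have hx1 : (1 : ℝ) < x := hx
  have hx0 : x ≠ 0 := (lt_trans one_pos hx1).ne'
  -- derivatives of `u`
  have hdu : DifferentiableOn ℝ u (Ioi 1) := hsmooth.differentiableOn (by simp)
  have hdu' : ContDiffOn ℝ ((⊤ : ℕ∞) : WithTop ℕ∞) (deriv u) (Ioi 1) :=
    ((contDiffOn_infty_iff_deriv_of_isOpen hopen).1 hsmooth).2
  have hddu : DifferentiableOn ℝ (deriv u) (Ioi 1) := hdu'.differentiableOn (by simp)
  have Hu : ∀ y ∈ Ioi (1 : ℝ), HasDerivAt u (deriv u y) y := fun y hy ↦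
    (hdu.differentiableAt (hopen.mem_nhds hy)).hasDerivAt
  have Hdu : HasDerivAt (deriv u) (deriv (deriv u) x) x :=
    (hddu.differentiableAt (hopen.mem_nhds hx)).hasDerivAt
  -- first derivative of `𝔥 = w u` near `x`
  set w₁ : ℝ → ℝ := fun y ↦ -(y ^ 2)⁻¹ + ω ^ 2 * (2 * y) with hw₁
  have hD1 : ∀ y ∈ Ioi (1 : ℝ), HasDerivAt (fun z ↦ glWeight ω z * u z)
      (w₁ y * u y + glWeight ω y * deriv u y) y := fun y hy ↦
    (hasDerivAt_glWeight ω (lt_trans one_pos (show (1 : ℝ) < y from hy)).ne').mul (Hu y hy)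
  have hderiv1 : deriv (fun z ↦ glWeight ω z * u z) =ᶠ[𝓝 x]
      fun y ↦ w₁ y * u y + glWeight ω y * deriv u y := by
    filter_upwards [hopen.mem_nhds hx] with y hy
    exact (hD1 y hy).deriv
  -- second derivative
  have hw₁d : HasDerivAt w₁ (2 * (x ^ 3)⁻¹ + 2 * ω ^ 2) x := by
    have := hasDerivAt_deriv_glWeight ω hx0
    refine this.congr_of_eventuallyEq ?_
    filter_upwards [isOpen_ne.mem_nhds hx0] with y hy
    exact ((hasDerivAt_glWeight ω hy).deriv).symm
  have hD2 : HasDerivAt (deriv (fun z ↦ glWeight ω z * u z))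
      ((2 * (x ^ 3)⁻¹ + 2 * ω ^ 2) * u x + w₁ x * deriv u x +
        (w₁ x * deriv u x + glWeight ω x * deriv (deriv u) x)) x := by
    refine HasDerivAt.congr_of_eventuallyEq ?_ hderiv1
    exact (hw₁d.mul (Hu x hx)).add ((hasDerivAt_glWeight ω hx0).mul Hdu)
  rw [hD2.deriv, (hD1 x hx).deriv]
  have hweight := glWeight_equation ω hx1
  have hpot := glPotential_equation ω hx1
  have hS := hode x hx
  simp only [hw₁]
  -- `(HZX)(w u) = u · (pot-identity) + u' · (weight-identity) + w · (ODEF)(u)`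
  have key : (2 * (x ^ 3)⁻¹ + 2 * ω ^ 2) * u x + (-(x ^ 2)⁻¹ + ω ^ 2 * (2 * x)) * deriv u x +
        ((-(x ^ 2)⁻¹ + ω ^ 2 * (2 * x)) * deriv u x + glWeight ω x * deriv (deriv u) x) +
        glP ω x * ((-(x ^ 2)⁻¹ + ω ^ 2 * (2 * x)) * u x + glWeight ω x * deriv u x) +
        (glQ ω x - μ ^ 2 * x ^ 2 / (x - 1) ^ 2) * (glWeight ω x * u x) =
      u x * ((2 * (x ^ 3)⁻¹ + 2 * ω ^ 2) + glP ω x * (-(x ^ 2)⁻¹ + ω ^ 2 * (2 * x)) +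
          glQ ω x * glWeight ω x) +
        deriv u x * (2 * (-(x ^ 2)⁻¹ + ω ^ 2 * (2 * x)) + glP ω x * glWeight ω x) +
        glWeight ω x * (deriv (deriv u) x + deriv u x / (x * (x - 1))) -
        glWeight ω x * (deriv u x / (x * (x - 1))) -
        μ ^ 2 * x ^ 2 / (x - 1) ^ 2 * (glWeight ω x * u x) := by ring
  rw [key, hpot, hweight, hS, hμ]
  ring

/-- The two densities of a function agreeing with `u` on `(1, ∞)` agree there (the `H¹`-density
only sees the restriction to the open half-line). [folklore] -/
lemma glH1Density_congr {u v : ℝ → ℝ} (h : EqOn u v (Ioi 1)) {x : ℝ} (hx : x ∈ Ioi (1 : ℝ)) :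
    glH1Density u x = glH1Density v x := by
  have hev : u =ᶠ[𝓝 x] v := by
    filter_upwards [isOpen_Ioi.mem_nhds hx] with y hy using h hy
  unfold glH1Density
  rw [hev.deriv_eq, h hx]

/-- `HasFiniteGLH1Norm` only depends on the restriction to `(1, ∞)`. [folklore] -/
lemma HasFiniteGLH1Norm.congr {u v : ℝ → ℝ} (hu : HasFiniteGLH1Norm u) (h : EqOn u v (Ioi 1)) :
    HasFiniteGLH1Norm v :=
  IntegrableOn.congr_fun hu (fun _ hx ↦ glH1Density_congr h hx) measurableSet_Ioi

/-- `√(1/4000) = 1/(20√10)`: the threshold of Prop. 4.6 ("`μ̂ = √(−E₀) > 1/(20√10)`").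
[cite: Collingbourne2021, proof of Prop. 4.6] -/
lemma one_div_twenty_sqrt_ten_sq : (1 / (20 * Real.sqrt 10)) ^ 2 = (1 : ℝ) / 4000 := by
  rw [div_pow, mul_pow, Real.sq_sqrt (by norm_num)]
  norm_num

/-- The test function is `C¹` (indeed smooth) on `(1, ∞)`. [folklore] -/
lemma contDiffOn_glTestFunction (ω : ℝ) : ContDiffOn ℝ 1 (glTestFunction ω) (Ioi 1) := by
  intro x hx
  have hx1 : x - 1 ≠ 0 := sub_ne_zero.2 (ne_of_gt hx)
  have h1 : ContDiffAt ℝ 1 (fun y : ℝ ↦ (y - 1) ^ ((1 : ℝ) / 100)) x :=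
    (Real.contDiffAt_rpow_const_of_ne (p := (1 : ℝ) / 100) hx1).comp x
      (contDiffAt_id.sub contDiffAt_const)
  have h2 : ContDiffAt ℝ 1
      (fun y : ℝ ↦ y * (1 + |ω| ^ 2 * y ^ 3) * (y - 1) ^ ((1 : ℝ) / 100) *
        Real.exp (-4 * |ω| * (y - 1))) x :=
    ((contDiffAt_id.mul (by fun_prop)).mul h1).mul (by fun_prop)
  exact h2.contDiffWithinAt

/-- A function with finite `H¹(ℝ)`-norm that is `C¹` on `(1, ∞)` has finite `L²(ℝ)`-norm:
`∫₁^∞ |ψ|² (x/(x−1)) dx < ∞`. [folklore] -/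
lemma HasFiniteGLH1Norm.integrableOn_sq {ψ : ℝ → ℝ} (hψ : HasFiniteGLH1Norm ψ)
    (hc : ContDiffOn ℝ 1 ψ (Ioi 1)) :
    IntegrableOn (fun x ↦ ψ x ^ 2 * (x / (x - 1))) (Ioi 1) := by
  have hcont : ContinuousOn ψ (Ioi 1) := hc.continuousOn
  have hmeas : AEStronglyMeasurable (fun x ↦ ψ x ^ 2 * (x / (x - 1)))
      (volume.restrict (Ioi 1)) := by
    refine ContinuousOn.aestronglyMeasurable ?_ measurableSet_Ioi
    refine (hcont.pow 2).mul (continuousOn_id.div (continuousOn_id.sub continuousOn_const) ?_)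
    exact fun x hx ↦ sub_ne_zero.2 (ne_of_gt hx)
  refine Integrable.mono' hψ hmeas ?_
  filter_upwards [self_mem_ae_restrict measurableSet_Ioi] with x hx
  have hx1 : (1 : ℝ) < x := hx
  have hw : 0 ≤ x / (x - 1) := div_nonneg (by linarith) (by linarith)
  rw [Real.norm_eq_abs, abs_of_nonneg (mul_nonneg (sq_nonneg _) hw)]
  unfold glH1Density
  nlinarith [sq_nonneg ((x - 1) / x * deriv ψ x), hw,
    mul_nonneg (sq_nonneg ((x - 1) / x * deriv ψ x)) hw]

/-- **Theorem 1.1 / Prop. 4.1 of Collingbourne from the two analytic facts of §4 (proved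
reduction).** Given Prop. 4.5 (`GregoryLaflammeTestEnergyBound`) and the variational
principle (`GregoryLaflammeNegativeEigenfunction`), for every `3/10 ≤ |ω̂| ≤ 8/10` there are
`μ̂ > 1/(20√10)` and a smooth solution `𝔥 ≢ 0` of (HZX) on `(1, ∞)` with `𝔥/w` of finite
`H¹(ℝ)`-norm: the proof of Prop. 4.6 (p. 22) followed by §4.1 (`𝔥 = w 𝔥̃`).
[cite: Collingbourne2021, §4.1 and proof of Prop. 4.6 (p. 22)] -/
theorem GregoryLaflammeInstability_of (hA : GregoryLaflammeTestEnergyBound)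
    (hB : GregoryLaflammeNegativeEigenfunction) : GregoryLaflammeInstability := by
  intro ω h1 h2
  obtain ⟨hfin, hint, hlt⟩ := hA ω h1 h2
  set ψ := glTestFunction ω with hψ
  set Eψ := ∫ x in Ioi 1, glEnergyDensity ω ψ x with hEψ
  set L := ∫ x in Ioi 1, ψ x ^ 2 * (x / (x - 1)) with hL
  have hL0 : 0 ≤ L := by
    refine setIntegral_nonneg measurableSet_Ioi fun x hx ↦ ?_
    have hx1 : (1 : ℝ) < x := hx
    exact mul_nonneg (sq_nonneg _) (div_nonneg (by linarith) (by linarith))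
  -- a strict intermediate level `E'` with `E(ψ) < E' L` and `E' < -1/4000`
  obtain ⟨E', hE'lt, hE'ψ⟩ : ∃ E' : ℝ, E' < -(1 / 4000) ∧ Eψ < E' * L := by
    rcases eq_or_lt_of_le hL0 with hL00 | hLpos
    · refine ⟨-(1 / 2000), by norm_num, ?_⟩
      rw [← hL00, mul_zero]
      simpa [← hL00] using hlt
    · refine ⟨(Eψ / L + -(1 / 4000)) / 2, ?_, ?_⟩
      · have : Eψ / L < -(1 / 4000) := by rwa [div_lt_iff₀ hLpos]
        linarith
      · have : Eψ / L < (Eψ / L + -(1 / 4000)) / 2 := by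
          have : Eψ / L < -(1 / 4000) := by rwa [div_lt_iff₀ hLpos]
          linarith
        calc Eψ = Eψ / L * L := by field_simp
          _ < (Eψ / L + -(1 / 4000)) / 2 * L := by gcongr
  have hE'neg : E' < 0 := by linarith
  obtain ⟨E, hEle, u, hmode, ⟨x₀, hx₀, hux₀⟩, hH1⟩ :=
    hB ω E' (ne_zero_of_mem_glBand h1) hE'neg ⟨ψ, contDiffOn_glTestFunction ω, hfin, hint, hE'ψ⟩
  have hEneg : 1 / 4000 < -E := by linarith
  set μ := Real.sqrt (-E) with hμ
  have hμsq : μ ^ 2 = -E := Real.sq_sqrt (by linarith)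
  refine ⟨μ, ?_, fun x ↦ glWeight ω x * u x, hmode.isGLRadialMode hμsq, ?_, ?_⟩
  · rw [hμ, Real.lt_sqrt (by positivity), one_div_twenty_sqrt_ten_sq]
    exact hEneg
  · exact ⟨x₀, hx₀, mul_ne_zero (glWeight_pos ω hx₀).ne' hux₀⟩
  · refine hH1.congr fun x hx ↦ ?_
    have hw : glWeight ω x ≠ 0 := (glWeight_pos ω hx).ne'
    field_simp

end Literature.Barriers.FinalStateConjecture

end
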